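import Mathlib
import Summits.ValiantsHypothesis.ValiantsHypothesis.Statement
import Summits.ValiantsHypothesis.ValiantsHypothesis.Theorems.SoloInformedRayGirth
import Summits.ValiantsHypothesis.ValiantsHypothesis.Theorems.SoloInformedPencilGirth
import HarnessLib

/-!
# Pencil girth without the support normalisation (soloist dossier, s35)

`soloInformed_pencilGirth` (file `SoloInformedPencilGirth`) carries the per-hub normalisation
"`W` contains no nonzero polynomial supported on `E_a`".  This file removes it: for an
arbitrary finite-dimensional `W ⊂ F[X]`, hubs `q_a`, and pairwise disjoint value sets `E_a`
realised on the common-line pencils `W + q_a W` (i.e. `q_a x = w + X^e`, `x, w ∈ W`), with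
`⋃ E_a` `(K,h)`-free, `K ≥ 4`, `h ≥ 1`, one has

  `Σ_{a<b} C(|E_a| + |E_b| − w_a − w_b − s, 2) ≤ s² + s · Σ_a |E_a|`,
  where `s = dim W` and `w_a = dim (W ∩ T_{E_a})`, `T_{E_a}` = polynomials supported on `E_a`,

(`soloInformed_pencilGirth_free`), together with `Σ_a w_a ≤ s`
(`solo_sum_finrank_inf_soloSuppIn_le`; the `W ∩ T_{E_a}` are independent because the `E_a`
are disjoint) and the corollary `soloInformed_pencilGirth_few_free`.

The reduction is the pivot lemma `solo_exists_support_complement`: a subspace `V` of the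
`E_a`-supported polynomials of dimension `w_a` misses all polynomials supported on some
`E_a' ⊆ E_a` with `|E_a'| ≥ |E_a| − w_a`; one applies `soloInformed_pencilGirth` to the
sub-family `E_a'` (freeness, disjointness and the realisations are inherited).

Consequence for the dossier (quadspan 2.70): the "many heavily loaded hubs on a common line"
template is excluded with NO side condition on `W`: hubs with `|E_a| ≥ (1/2+δ)s` and
`w_a ≤ δs/4` number `O(δ⁻²)`, and at most `4/δ` hubs have `w_a > δs/4`.  It is NOT a proof of
the `O(s^{1+o(1)})` value bound: half-loaded pencils (`|E_a| ≤ s/2`) and hubs on distinct lines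
remain open (see the docstring of `SoloInformedPencilGirth`).
-/

namespace Summit.ValiantsHypothesis.ValiantsHypothesis.Theorems

open Finset Polynomial Module
open scoped Pointwise

/-- Pivot lemma: a finite-dimensional subspace `V ⊂ F[X]` misses the polynomials supported on
some `T' ⊆ T` with `|T| ≤ |T'| + dim V`. -/
theorem solo_exists_support_complement {F : Type*} [Field F] (V : Submodule F F[X])
    [FiniteDimensional F V] (T : Finset ℕ) :
    ∃ T' ⊆ T, T.card ≤ T'.card + finrank F V ∧
      ∀ f ∈ V, f ∈ soloSuppIn F (T' : Set ℕ) → f = 0 := by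
  classical
  suffices h : ∀ n : ℕ, ∀ T' : Finset ℕ, T' ⊆ T →
      finrank F ↥(V ⊓ soloSuppIn F (T' : Set ℕ)) ≤ n →
      ∃ T'' ⊆ T, T'.card ≤ T''.card + n ∧
        ∀ f ∈ V, f ∈ soloSuppIn F (T'' : Set ℕ) → f = 0 by
    exact h (finrank F V) T subset_rfl (Submodule.finrank_mono inf_le_left)
  intro n
  induction n with
  | zero =>
    intro T' hT' hfin
    refine ⟨T', hT', by simp, fun f hf hfs => ?_⟩
    have h0 : V ⊓ soloSuppIn F (T' : Set ℕ) = ⊥ :=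
      Submodule.finrank_eq_zero.mp (Nat.le_zero.mp hfin)
    have hmem : f ∈ V ⊓ soloSuppIn F (T' : Set ℕ) := ⟨hf, hfs⟩
    rw [h0] at hmem
    exact (Submodule.mem_bot F).mp hmem
  | succ n ih =>
    intro T' hT' hfin
    by_cases hz : ∀ f ∈ V, f ∈ soloSuppIn F (T' : Set ℕ) → f = 0
    · exact ⟨T', hT', by omega, hz⟩
    push Not at hz
    obtain ⟨f, hfV, hfs, hf0⟩ := hz
    have hk : ∃ k ∈ T', f.coeff k ≠ 0 := by
      by_contra hcon
      push Not at hcon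
      apply hf0
      ext k
      rw [Polynomial.coeff_zero]
      by_cases hkT : k ∈ T'
      · exact hcon k hkT
      · exact hfs k (fun hk' => hkT (Finset.mem_coe.mp hk'))
    obtain ⟨k, hkT, hfk⟩ := hk
    have hlt : finrank F ↥(V ⊓ soloSuppIn F ((T'.erase k : Finset ℕ) : Set ℕ)) ≤ n := by
      have hle : V ⊓ soloSuppIn F ((T'.erase k : Finset ℕ) : Set ℕ) ≤
          V ⊓ soloSuppIn F (T' : Set ℕ) :=
        inf_le_inf_left _ (soloSuppIn_mono (Finset.coe_subset.mpr (Finset.erase_subset k T')))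
      have hne : V ⊓ soloSuppIn F ((T'.erase k : Finset ℕ) : Set ℕ) ≠
          V ⊓ soloSuppIn F (T' : Set ℕ) := by
        intro heq
        have hmem : f ∈ V ⊓ soloSuppIn F (T' : Set ℕ) := ⟨hfV, hfs⟩
        rw [← heq] at hmem
        exact hfk (hmem.2 k (by simp))
      have := Submodule.finrank_lt_finrank_of_lt (lt_of_le_of_ne hle hne)
      omega
    obtain ⟨T'', hT'', hcard, hzero⟩ :=
      ih (T'.erase k) ((Finset.erase_subset k T').trans hT') hlt
    refine ⟨T'', hT'', ?_, hzero⟩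
    have := Finset.card_erase_add_one hkT
    omega

/-- For pairwise disjoint `E a`, the subspaces `W ∩ (polynomials supported on E a)` are
independent, so their dimensions add up to at most `dim W`. -/
theorem solo_sum_finrank_inf_soloSuppIn_le {F : Type*} [Field F] {ι : Type*} (B : Finset ι)
    (W : Submodule F F[X]) [FiniteDimensional F W] (E : ι → Finset ℕ)
    (hdisj : ∀ a ∈ B, ∀ b ∈ B, a ≠ b → Disjoint (E a) (E b)) :
    ∑ a ∈ B, finrank F ↥(W ⊓ soloSuppIn F ((E a : Finset ℕ) : Set ℕ)) ≤ finrank F W := by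
  classical
  set Wa : ↥B → Submodule F F[X] := fun a => W ⊓ soloSuppIn F ((E a : Finset ℕ) : Set ℕ)
    with hWa
  haveI : ∀ a : ↥B, FiniteDimensional F ↥(Wa a) := fun a =>
    Submodule.finiteDimensional_of_le (inf_le_left : Wa a ≤ W)
  set φ : (Π a : ↥B, ↥(Wa a)) →ₗ[F] F[X] :=
    ∑ a : ↥B, (Wa a).subtype.comp (LinearMap.proj a) with hφ
  have hφapp : ∀ f : Π a : ↥B, ↥(Wa a), φ f = ∑ a, (f a : F[X]) := by
    intro f
    simp [hφ, LinearMap.sum_apply]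
  have hφW : ∀ f, φ f ∈ W := fun f => by
    rw [hφapp]
    exact W.sum_mem fun a _ => (f a).2.1
  have hinj : Function.Injective φ := by
    intro f g hfg
    have h0 : φ (f - g) = 0 := by rw [map_sub, hfg, sub_self]
    have key : f - g = 0 := by
      funext a
      apply Subtype.ext
      ext k
      simp only [Pi.zero_apply, ZeroMemClass.coe_zero, coeff_zero]
      by_cases hk : k ∈ E a
      · have hsum := congrArg (fun p : F[X] => p.coeff k) (hφapp (f - g))
        rw [h0, coeff_zero, finsetSum_coeff] at hsum
        rw [Finset.sum_eq_single a] at hsum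
        · exact hsum.symm
        · intro b _ hba
          apply ((f - g) b).2.2 k
          intro hkb
          have hab : (a : ι) ≠ b := fun h => hba (Subtype.ext h).symm
          exact Finset.disjoint_left.mp (hdisj a a.2 b b.2 hab) hk (Finset.mem_coe.mp hkb)
        · intro h
          exact absurd (Finset.mem_univ a) h
      · exact ((f - g) a).2.2 k (fun hk' => hk (Finset.mem_coe.mp hk'))
    exact sub_eq_zero.mp key
  have hinj' : Function.Injective (LinearMap.codRestrict W φ hφW) := by
    intro f g hfg
    apply hinj
    have := congrArg Subtype.val hfg
    simpa using this
  have hle := LinearMap.finrank_le_finrank_of_injective hinj'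
  rw [Module.finrank_pi_fintype] at hle
  calc ∑ a ∈ B, finrank F ↥(W ⊓ soloSuppIn F ((E a : Finset ℕ) : Set ℕ))
      = ∑ a : ↥B, finrank F ↥(Wa a) := (Finset.sum_coe_sort _ _).symm
    _ ≤ finrank F W := hle

/-- **Pencil girth, free of the support normalisation.**  `W ⊂ F[X]` finite-dimensional,
hubs `q a`, pairwise disjoint value sets `E a` (`a ∈ B`) with `q a * x = w + X^e`
(`x, w ∈ W`) for every `e ∈ E a`, and `⋃ E a` `(K,h)`-free with `K ≥ 4`, `h ≥ 1`.  Then, with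
`s = dim W` and `w a = dim (W ∩ T_{E a})`,
`Σ_{a<b} C(|E a| + |E b| − (w a + w b + s), 2) ≤ s² + s · Σ_a |E a|`. -/
theorem soloInformed_pencilGirth_free {F : Type*} [Field F] {ι : Type*} [LinearOrder ι]
    (B : Finset ι) (W : Submodule F F[X]) [FiniteDimensional F W] (q : ι → F[X])
    (E : ι → Finset ℕ) {K h : ℕ} (hK : 4 ≤ K) (hh : 1 ≤ h)
    (hfree : SoloNatFree K h (B.biUnion E))
    (hdisj : ∀ a ∈ B, ∀ b ∈ B, a ≠ b → Disjoint (E a) (E b))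
    (hreal : ∀ a ∈ B, ∀ e ∈ E a, ∃ x ∈ W, ∃ w ∈ W, q a * x = w + X ^ e) :
    ∑ p ∈ B.offDiag with p.1 < p.2,
        ((E p.1).card + (E p.2).card -
          (finrank F ↥(W ⊓ soloSuppIn F ((E p.1 : Finset ℕ) : Set ℕ)) +
            finrank F ↥(W ⊓ soloSuppIn F ((E p.2 : Finset ℕ) : Set ℕ)) + finrank F W)).choose 2
      ≤ finrank F W ^ 2 + finrank F W * ∑ a ∈ B, (E a).card := by
  classical
  have hsub : ∀ a, ∃ T' ⊆ E a,
      (E a).card ≤ T'.card + finrank F ↥(W ⊓ soloSuppIn F ((E a : Finset ℕ) : Set ℕ)) ∧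
      ∀ f ∈ W ⊓ soloSuppIn F ((E a : Finset ℕ) : Set ℕ),
        f ∈ soloSuppIn F (T' : Set ℕ) → f = 0 :=
    fun a => solo_exists_support_complement _ (E a)
  choose E' hE'sub hE'card hE'zero using hsub
  have h1 := soloInformed_pencilGirth B W q E' hK hh
    (hfree.anti (Finset.biUnion_mono fun a _ => hE'sub a))
    (fun a ha b hb hab => (hdisj a ha b hb hab).mono (hE'sub a) (hE'sub b))
    (fun a _ f hf hfs => hE'zero a f
      ⟨hf, fun k hk => hfs k fun hk' => hk (Finset.mem_coe.mpr (hE'sub a hk'))⟩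
      fun k hk => hfs k fun hk' => hk (Finset.mem_coe.mp hk'))
    (fun a ha e he => hreal a ha e (hE'sub a he))
  have h2 : ∑ a ∈ B, (E' a).card ≤ ∑ a ∈ B, (E a).card :=
    Finset.sum_le_sum fun a _ => Finset.card_le_card (hE'sub a)
  calc _ ≤ ∑ p ∈ B.offDiag with p.1 < p.2,
          ((E' p.1).card + (E' p.2).card - finrank F W).choose 2 :=
        Finset.sum_le_sum fun p _ => Nat.choose_le_choose 2 (by
          have ha := hE'card p.1
          have hb := hE'card p.2
          omega)
    _ ≤ finrank F W ^ 2 + finrank F W * ∑ a ∈ B, (E' a).card := h1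
    _ ≤ finrank F W ^ 2 + finrank F W * ∑ a ∈ B, (E a).card :=
        Nat.add_le_add_left (Nat.mul_le_mul_left _ h2) _

/-- **Big pencils are few (no side condition on `W`).**  If every hub `a ∈ B` satisfies
`s + d + 2·w a ≤ 2·|E a|` (with `w a = dim (W ∩ T_{E a})`) and `|E a| ≤ R`, then
`C(|B|,2)·C(d,2) ≤ s² + s·(|B|·R)`.  (Combine with `solo_sum_finrank_inf_soloSuppIn_le`:
`Σ_a w a ≤ s`, so all but `s/w₀` hubs have `w a ≤ w₀`.) -/
theorem soloInformed_pencilGirth_few_free {F : Type*} [Field F] {ι : Type*} [LinearOrder ι]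
    (B : Finset ι) (W : Submodule F F[X]) [FiniteDimensional F W] (q : ι → F[X])
    (E : ι → Finset ℕ) {K h : ℕ} (hK : 4 ≤ K) (hh : 1 ≤ h)
    (hfree : SoloNatFree K h (B.biUnion E))
    (hdisj : ∀ a ∈ B, ∀ b ∈ B, a ≠ b → Disjoint (E a) (E b))
    (hreal : ∀ a ∈ B, ∀ e ∈ E a, ∃ x ∈ W, ∃ w ∈ W, q a * x = w + X ^ e)
    {d R : ℕ}
    (hbig : ∀ a ∈ B, finrank F W + d +
      2 * finrank F ↥(W ⊓ soloSuppIn F ((E a : Finset ℕ) : Set ℕ)) ≤ 2 * (E a).card)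
    (hR : ∀ a ∈ B, (E a).card ≤ R) :
    B.card.choose 2 * d.choose 2 ≤ finrank F W ^ 2 + finrank F W * (B.card * R) := by
  classical
  have hmain := soloInformed_pencilGirth_free B W q E hK hh hfree hdisj hreal
  set PIs := B.offDiag.filter (fun p : ι × ι => p.1 < p.2) with hPIs
  have hcardPI : B.card.choose 2 ≤ PIs.card := solo_choose_two_le_card_ltPairs B
  have h1 : B.card.choose 2 * d.choose 2 ≤
      ∑ p ∈ PIs, ((E p.1).card + (E p.2).card -
          (finrank F ↥(W ⊓ soloSuppIn F ((E p.1 : Finset ℕ) : Set ℕ)) +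
            finrank F ↥(W ⊓ soloSuppIn F ((E p.2 : Finset ℕ) : Set ℕ)) +
              finrank F W)).choose 2 := by
    calc B.card.choose 2 * d.choose 2 ≤ PIs.card * d.choose 2 := Nat.mul_le_mul_right _ hcardPI
      _ = ∑ p ∈ PIs, d.choose 2 := by rw [Finset.sum_const, smul_eq_mul]
      _ ≤ _ := Finset.sum_le_sum fun p hp => by
          have hp' : p.1 ∈ B ∧ p.2 ∈ B := by
            simp only [hPIs, Finset.mem_filter, Finset.mem_offDiag] at hp
            exact ⟨hp.1.1, hp.1.2.1⟩
          apply Nat.choose_le_choose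
          have := hbig _ hp'.1
          have := hbig _ hp'.2
          omega
  have h2 : ∑ a ∈ B, (E a).card ≤ B.card * R := by
    calc ∑ a ∈ B, (E a).card ≤ ∑ a ∈ B, R := Finset.sum_le_sum hR
      _ = B.card * R := by rw [Finset.sum_const, smul_eq_mul]
  calc B.card.choose 2 * d.choose 2 ≤ _ := h1
    _ ≤ finrank F W ^ 2 + finrank F W * ∑ a ∈ B, (E a).card := hmain
    _ ≤ finrank F W ^ 2 + finrank F W * (B.card * R) :=
        Nat.add_le_add_left (Nat.mul_le_mul_left _ h2) _

end Summit.ValiantsHypothesis.ValiantsHypothesis.Theorems
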